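import Literature.AnabelianGeometry.AbsoluteAnabelian.AbsTopIII.CurveModel
import Literature.AnabelianGeometry.AbsoluteAnabelian.MLFGaloisTypeProofs
import Literature.AnabelianGeometry.AbsoluteAnabelian.MLFAbsoluteGaloisGroupInfinite
import HarnessLib

/-!
# [AbsTopIII] Prop. 1.4 (i), Rmk. 1.9.2 relative to a model: the universal closures over the INTERFACE are refuted

Mochizuki, *Topics in Absolute Anabelian Geometry III*, §1 (lit key `paper:url-5493eb38cbb7`),
Prop. 1.4 (i) p. 31 ("the inertia group `I_x` of `x` in `Δ_U` is naturally isomorphic to `Ẑ(1)`") and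
Rmk. 1.9.2 p. 38 ("When `k` is an MLF or NF, the extension `1 → Δ_X → Π_X → G_k → 1` may be replaced
by the single profinite group `Π_X`").  abc-iut-L4-t1 typed both as NAMED FACTS RELATIVE TO A MODEL
`M : CurveModel` (`CurveModel.Prop_1_4_i M`, `CurveModel.Rmk_1_9_2 M`; FACT-LIST F-0339, F-0236),
and `CurveModel` is an INTERFACE: a record of data with no existence or coherence axiom
(`CurveModel.lean` module text: "nothing here asserts that a model exists"; the record is inhabited by
degenerate toys, `AbsTopIII.CurveModel.nonempty_degenerate`).

Consequently the UNIVERSAL CLOSURES `∀ M, M.Prop_1_4_i` and `∀ M, M.Rmk_1_9_2` range over junk models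
and are FALSE; this proof-only file (no definitions) records the kernel refutations, so that no cone
file binds a universal closure as a hypothesis (it would be inconsistent) and the rows are consumed AT
NAMED INSTANCES / instance classes only (FACT-LIST rule R5; the instance-class PROOFS of Rmk. 1.9.2 are
in `CurveModelRmk192Proofs.lean`):

* `CurveModel.not_forall_prop_1_4_i` — a one-curve toy over `ℚ_2` whose single cusp has decomposition
  group `Π` and TRIVIAL inertia group (`Π = G`, `Δ = 1`): a trivial group has no open subgroup of
  index `2`, so it is not free procyclic;
* `CurveModel.not_forall_rmk_1_9_2` — a one-curve toy over the MLF `ℚ_2` with `Π := G × G`,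
  `G = Gal(ℚ̄_2/ℚ_2)`, augmentation the second projection (`Δ = G × 1`): the swap automorphism of
  `Π` does not preserve `Δ` because `G ≠ 1` (`Padic.infinite_absoluteGaloisGroup`).  (Here `Δ ≅ G`
  is topologically finitely generated but the regime hypothesis `CoinvariantRankConstant` of the
  instance-class theorem fails, as it must.)

HONEST FRAMING: statements about the cell's own typing (junk instances of an interface), not about
[AbsTopIII]; Prop. 1.4 (i) and Rmk. 1.9.2 themselves are refereed, undisputed results about the étale
fundamental groups of hyperbolic curves, which the tree does not construct; nothing here bears on
[IUTchIII] Cor. 3.12; typed ≠ proved.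
-/

noncomputable section

open CategoryTheory

namespace Literature.AnabelianGeometry.AbsoluteAnabelian.AbsTopIII.CurveModel

open FundamentalExtension

/-- **The universal closure of `CurveModel.Prop_1_4_i` is false.**  Witness: the one-curve model over
`ℚ_2` with the "point" extension `Π = G = Gal(ℚ̄_2/ℚ_2)` (`Δ = 1`), declared scheme-like, with ONE cusp
whose decomposition group is `Π` and whose inertia group is therefore `Π ∩ Δ = 1`; a trivial profinite
group has no open subgroup of index `2`, hence is not free procyclic (`IsFreeProcyclic`), so
`(M.cusps U).InertiaFreeProcyclic` fails.  The printed Prop. 1.4 (i) is about étale fundamental groups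
of hyperbolic curves and is not touched. [cite: MochizukiAbsTopIII2015, Prop 1.4 (i) p.31] -/
theorem not_forall_prop_1_4_i : ¬ ∀ M : CurveModel.{0}, M.Prop_1_4_i := by
  intro h
  -- the point extension `Π = G = G_{ℚ_2}`
  let E₀ : FundamentalExtension.{0} :=
    { arith := absoluteGaloisGrp ℚ_[2], gal := absoluteGaloisGrp ℚ_[2],
      aug := ContinuousMonoidHom.id _, aug_surjective := Function.surjective_id }
  have hgeom : E₀.geom = ⊥ := (MonoidHom.ker_eq_bot_iff _).mpr Function.injective_id
  -- one cusp with decomposition group `⊤`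
  let C₀ : E₀.CuspidalData :=
    { Cusp := PUnit.{1}
      Dcusp := fun _ => ⊤
      Icusp := fun _ => ⊤ ⊓ E₀.geom
      Icusp_eq := fun _ => rfl
      isClosed_Dcusp := fun _ => by
        rw [Subgroup.coe_top]
        exact isClosed_univ
      eq_of_conj := fun x y _ _ => Subsingleton.elim x y }
  let M : CurveModel.{0} :=
    { Curve := PUnit.{2}
      base := fun _ => ℚ_[2]
      ext := fun _ => E₀
      galIso := fun _ => Iso.refl _
      cusps := fun _ => C₀
      IsProper := fun _ => False
      IsScheme := fun _ => True
      genus := fun _ => 0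
      FunctionField := fun _ => ℚ_[2]
      Point := fun _ => PEmpty.{1}
      decomp := fun _ x => x.elim
      IsNFCurve := fun _ => False
      IsNFPoint := fun _ x => x.elim
      IsNFRational := fun _ _ => False
      IsNFConstant := fun _ _ => False
      NFFunctionField := fun _ => ℚ_[2]
      IsStrictlyBelyiType := fun _ => False
      IsCofiniteOpen := fun U U' => U = U'
      res := fun {U U'} _ => 𝟙 E₀ }
  have hI : IsFreeProcyclic (C₀.Icusp PUnit.unit) := h M PUnit.unit trivial PUnit.unit
  -- the inertia group is trivial
  have hsub : Subsingleton (C₀.Icusp PUnit.unit) := by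
    refine ⟨fun a b => Subtype.ext ?_⟩
    have ha : (a : E₀.arith) ∈ E₀.geom := (Subgroup.mem_inf.mp a.2).2
    have hb : (b : E₀.arith) ∈ E₀.geom := (Subgroup.mem_inf.mp b.2).2
    rw [hgeom, Subgroup.mem_bot] at ha hb
    rw [ha, hb]
  -- hence it has no subgroup of index `2`
  obtain ⟨H, -, hH⟩ := hI.exists_isOpen_index 2 two_pos
  haveI := hsub
  have hHtop : H = ⊤ := by
    ext x
    rw [Subsingleton.elim x 1]
    exact ⟨fun _ => Subgroup.mem_top _, fun _ => H.one_mem⟩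
  rw [hHtop, Subgroup.index_top] at hH
  exact absurd hH (by norm_num)

/-- **The universal closure of `CurveModel.Rmk_1_9_2` is false.**  Witness: the one-curve model over
the MLF `ℚ_2` (`isMLF_padic`) with `Π := G × G`, `G = Gal(ℚ̄_2/ℚ_2)`, augmentation the second
projection, so `Δ = G × 1`; the swap `(a, b) ↦ (b, a)` is an automorphism of the profinite group `Π`
carrying `Δ` to `1 × G ≠ Δ`, since `G` is nontrivial (`Padic.infinite_absoluteGaloisGroup`).  This junk
`Δ` violates the regime hypothesis of the instance-class theorem
`rmk_1_9_2_of_geomTFG_of_coinvariantRankConstant`; the printed Rmk. 1.9.2 ([AbsTopI] Thm. 2.6 (v),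
(vi)) is not touched. [cite: MochizukiAbsTopIII2015, Rmk 1.9.2 p.38] -/
theorem not_forall_rmk_1_9_2 : ¬ ∀ M : CurveModel.{0}, M.Rmk_1_9_2 := by
  intro h
  -- `Π := G × G ↠ G` (second projection), `G = G_{ℚ_2}`
  let E₁ : FundamentalExtension.{0} :=
    { arith := ProfiniteGrp.of (Field.absoluteGaloisGroup ℚ_[2] × Field.absoluteGaloisGroup ℚ_[2])
      gal := absoluteGaloisGrp ℚ_[2]
      aug := ContinuousMonoidHom.snd (Field.absoluteGaloisGroup ℚ_[2]) (Field.absoluteGaloisGroup ℚ_[2])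
      aug_surjective := Prod.snd_surjective }
  obtain ⟨C₁⟩ : Nonempty E₁.CuspidalData :=
    ⟨{ Cusp := PEmpty.{1}
       Dcusp := fun x => x.elim
       Icusp := fun x => x.elim
       Icusp_eq := fun x => x.elim
       isClosed_Dcusp := fun x => x.elim
       eq_of_conj := fun x => x.elim }⟩
  let M : CurveModel.{0} :=
    { Curve := PUnit.{2}
      base := fun _ => ℚ_[2]
      ext := fun _ => E₁
      galIso := fun _ => Iso.refl _
      cusps := fun _ => C₁
      IsProper := fun _ => True
      IsScheme := fun _ => True
      genus := fun _ => 0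
      FunctionField := fun _ => ℚ_[2]
      Point := fun _ => PEmpty.{1}
      decomp := fun _ x => x.elim
      IsNFCurve := fun _ => False
      IsNFPoint := fun _ x => x.elim
      IsNFRational := fun _ _ => False
      IsNFConstant := fun _ _ => False
      NFFunctionField := fun _ => ℚ_[2]
      IsStrictlyBelyiType := fun _ => False
      IsCofiniteOpen := fun U U' => U = U'
      res := fun {U U'} _ => 𝟙 E₁ }
  -- the swap automorphism of `Π = G × G`
  let sw : E₁.arith ≃ₜ* E₁.arith :=
    { (MulEquiv.prodComm : (Field.absoluteGaloisGroup ℚ_[2] × Field.absoluteGaloisGroup ℚ_[2]) ≃*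
        (Field.absoluteGaloisGroup ℚ_[2] × Field.absoluteGaloisGroup ℚ_[2])) with
      continuous_toFun := continuous_swap
      continuous_invFun := continuous_swap }
  have hsw : E₁.geom.map sw.toMonoidHom = E₁.geom :=
    h M PUnit.unit PUnit.unit (Or.inl ⟨isMLF_padic 2, isMLF_padic 2⟩) sw
  -- a nontrivial element of `G`
  haveI := Padic.infinite_absoluteGaloisGroup (p := 2)
  obtain ⟨g, hg⟩ := exists_ne (1 : Field.absoluteGaloisGroup ℚ_[2])
  -- `(g, 1) ∈ Δ`, so `(1, g) = sw (g, 1) ∈ sw(Δ) = Δ`, i.e. `g = 1`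
  have hmem : ((g, 1) : E₁.arith) ∈ E₁.geom := by
    rw [mem_geom]
    rfl
  have hmem' : ((1, g) : E₁.arith) ∈ E₁.geom := by
    rw [← hsw, Subgroup.mem_map]
    exact ⟨(g, 1), hmem, rfl⟩
  rw [mem_geom] at hmem'
  exact hg hmem'

end Literature.AnabelianGeometry.AbsoluteAnabelian.AbsTopIII.CurveModel
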